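import Mathlib
import Literature.AlgebraicGeometry.HodgeTheory.WeilClassesCyclicPrym
import Literature.AlgebraicGeometry.VanGeemenVerra2003.QuaternionicHodgeClasses
import HarnessLib

/-!
# WeilClassesCyclicPrymDegreeFourRamified

Topic `Literature/AlgebraicGeometry/HodgeTheory`. Named literature fact(s) relocated by the gate from `Summits/HodgeConjecture/HodgeConjecture/Theorems/WeilTypeLadderQuaternionicPrymSixfolds.lean`
(accept-time relocation of `[cite]`d propositions written inline in a Summits proposal; human ruling 2026-08-15).
Sources: Schoen1988HodgeWeil.

* `Literature.AlgebraicGeometry.HodgeTheory.Schoen1988_cyclicPrym_weilClasses_algebraic_degreeFour_twoBranchPoints`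
-/

namespace Literature.AlgebraicGeometry.HodgeTheory

open CategoryTheory
open Literature.AlgebraicGeometry Literature.AlgebraicGeometry.Motives
open Literature.AlgebraicGeometry.HodgeTheory
open Literature.AlgebraicTopology.SingularHomology
open Literature.AlgebraicGeometry.VanGeemenVerra2003

/-- **Schoen's cyclic theorem, degree `4` over genus `3` with TWO branch points: the primitive Prym SIXFOLD of
`ℚ(i)`-Weil type** (Schoen 1988, Thm. 2.0 + Cor. 3.1 at `(q, m, r) = (3, 4, 1)`), on the tree's carriers — the
RAMIFIED (`r = 1`) sibling of `Schoen1988_cyclicPrym_weilClasses_algebraic_degreeFour` (`(5, 4, 0)`), same rendering.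
PRINTED STATEMENT: Schoen 1988 (Compositio Math. 65), §2 (p. 11): "Let `C` be an irreducible, smooth, projective curve
… Suppose that an embedding `σ : ℤ/m → Aut(C)` is given. Assume that the invariant `h` associated to `(C, σ)` in §1 is
even. This implies that the number of branch points of the canonical quotient map `π : C → X` is an even number (1.5),
which will be denoted `2r`. … THEOREM 2.0: If the `(ℤ/m)^*` orbit in `(ℤ/m - {0})^{2r}` associated to `(C, σ)` is
simple, then the subspace `U ⊂ H^h(C^h, ℚ(h/2))` is generated by fundamental classes of algebraic cycles"; p. 12:
"Note that the simplicity hypothesis is automatically satisfied if `r = 0` or `1`"; Lemma 1.5 (p. 7): "`h = -e(X°)`"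
(`X° ⊂ X` the locus over which `π` is unramified); §3 (p. 24): `B ⊂ Alb(C)` "the abelian subvariety whose tangent space
is the subspace of `T_e Alb(C)` where `ℤ/m` acts by primitive characters … the image of the composition, `P`, of all
elements `Σ_{τ ∈ H}(Id - τ)` [over] the non-zero subgroups `H` of `ℤ/m`", `U' ⊂ ⋀^h H¹(B, ℚ)` Weil's Hodge substructure
of `(B, ℚ(μ_m))` (`h = dim_{ℚ(μ_m)} H¹(B, ℚ)`; "`U' ⊗ ℂ` has pure Hodge type `(h/2, h/2)`"), and "CORROLLARY 3.1: If
`(C, σ)` satisfies the hypotheses of (2.0), then `U' ⊂ H^h(B, ℚ)` is generated by fundamental classes of codimension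
`h/2` algebraic cycles." RENDERING (dictionary steps marked; binder shape of the siblings): `C` is a smooth projective
complex curve with a Jacobian `𝒥` of dimension `11` (= `g(C)`) and an automorphism `α` with `α⁴ = 𝟙`, WITHOUT fixed
complex points, whose square `α²` has EXACTLY FOUR fixed complex points — so `σ := α` embeds `ℤ/4` in `Aut(C)`, the
stabilisers are `{1, α²}` at those four points and trivial elsewhere, the four points form TWO `⟨α⟩`-orbits,
`π : C → X := C/⟨α⟩` has exactly `2 = 2r` branch points (`r = 1`), each with two preimages of ramification index `2`,
and by Riemann–Hurwitz `2·11 - 2 = 4·(2g(X) - 2) + 4`, i.e. `g(X) = 3`, so `h = -e(X°) = -((2 - 2·3) - 2) = 6`, even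
as §2 requires; `s := α_*` (`Jacobian.pushforward`), a binder `e = s ≫ s`, and `B := (ker (𝟙 + e))⁰ = (ker Φ₄(s))⁰`
(`AbelianVariety.kerComponent`) = Schoen's `B` for `m = 4` (the image of `(Id - s²)(Id - s)`: the abelian subvariety
with `H₁ = {s² = -1}`, on whose tangent space `⟨α⟩` acts through `± i`; an abelian SIXFOLD, `dim_ℚ H₁(B) = 2h = 12`);
`s_B` the restriction of `s` (`s_B² = -𝟙`), Weil operator `ψ₀ := s_B` (`ℚ(ψ₀) = ℚ(i)`). TYPING (bookkeeping NOT in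
print, as the siblings): `weilClassesOf B ψ₀ 3 1 = E₊ ⊔ E₋ = ⋀⁶ H¹_{i} ⊕ ⋀⁶ H¹_{-i} = U' ⊗ ℂ`, and "`U'` is generated
by … algebraic cycles" is "every class of `weilClassesOf B ψ₀ 3 1` lies in `algebraicClasses B.X 3`". CONSUMER: the
Prym sixfolds of Donagi–Livné's ramified quaternionic towers `(g, a) = (2, 1)` (arXiv:math/0507493 §2), via `⟨i⟩ ⊂ Q`.
-- TODO(general form): Schoen Cor. 3.1 for all `(q, m, r)` with a simple orbit, once the tree has branch data of
-- cyclic covers and `⋀^h_{ℚ(μ_m)}` on real carriers.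
[cite: Schoen1988HodgeWeil, Thm 2.0 (p. 11–12), Lemma 1.5 (p. 7) and Cor 3.1 (p. 24), at (q, m, r) = (3, 4, 1)]
[file AlgebraicGeometry/HodgeTheory/WeilClassesCyclicPrymDegreeFourRamified] -/
def Schoen1988_cyclicPrym_weilClasses_algebraic_degreeFour_twoBranchPoints : Prop :=
  ∀ (C : SchemeOver ℂ) (𝒥 : Jacobian C) (α : C ⟶ C),
    IsSmoothProjective 1 C → 𝒥.J.dim = 11 →
    α ≫ α ≫ α ≫ α = 𝟙 C →
    (∀ P : ComplexPoints C, P ≫ α ≠ P) →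
    (∃ P₁ P₂ P₃ P₄ : ComplexPoints C, P₁ ≠ P₂ ∧ P₁ ≠ P₃ ∧ P₁ ≠ P₄ ∧ P₂ ≠ P₃ ∧ P₂ ≠ P₄ ∧ P₃ ≠ P₄ ∧
      ∀ P : ComplexPoints C, P ≫ (α ≫ α) = P ↔ (P = P₁ ∨ P = P₂ ∨ P = P₃ ∨ P = P₄)) →
  ∀ (s e : 𝒥.J ⟶ 𝒥.J), s = 𝒥.pushforward 𝒥 α → e = s ≫ s →
  ∀ (sB : AbelianVariety.kerComponent (𝟙 𝒥.J + e) ⟶ AbelianVariety.kerComponent (𝟙 𝒥.J + e)),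
    sB ≫ AbelianVariety.kerComponentι (𝟙 𝒥.J + e) = AbelianVariety.kerComponentι (𝟙 𝒥.J + e) ≫ s →
  ∀ c ∈ weilClassesOf (AbelianVariety.kerComponent (𝟙 𝒥.J + e)) sB 3 1,
    c ∈ algebraicClasses (AbelianVariety.kerComponent (𝟙 𝒥.J + e)).X 3

/-! ### The theorems on the quaternionic Prym SIXFOLD `P` -/

end Literature.AlgebraicGeometry.HodgeTheory
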